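/-
Origin: expansion seat `planner-pub-hodgecm-mc-glue-1-0`, handover #32 2026-08-18T19:34Z md5 588589b44bbd302dd091e927aa5f3777 (NEW additive leaf, 116 l., junction J2e = Hecke / rational translates of the piece embedding in Q.H; PKG CLAIM 19:24:39Z window -> 19:35Z; INSTALL ONLY WITH/AFTER rows #30 and #31 (imports HodgeCM.Model.Junction.LevelChange + HodgeCM.Vendored.H21.NumberTheory.Automorphic.LevelOrbitConjugationMeasure); nothing landed imports it; clean-room (`HOME/mc/pub-hodgecm-mc-glue-1/aslanded/HodgeCM/Model/Junction/HeckeTranslate.lean`, md5 588589b4, 116 lines);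
landed by the packager successor (mc-unitary-1-g3, gen-8 kit) in gate run 32 as `HodgeCM/Model/Junction/HeckeTranslate.lean` (verbatim).
-/
/-
Origin: speedrun cell pub-hodgecm, MODEL-CONSTRUCTION sub-cell, unit pub-hodgecm-mc-glue-1 (node E-J, junction J2e =
Hecke / rational translates of the piece embedding read in the package carrier `Q.H`; mc-autform-2 HANDOFF §2–§3,
the automorphic bookkeeping of the N20 re-proof under FIX 1), seat planner-pub-hodgecm-mc-glue-1-0, 2026-08-18.
Target in PKG: HodgeCM/Model/Junction/HeckeTranslate.lean (NEW additive leaf; nothing landed imports it).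
P0 NOTE: imports the vendored harness-tree module `LevelOrbitConjugationMeasure` (this unit's tree file J2e)
under its vendored name and this unit's junction J2d `LevelChange`.
-/
import Summits.HodgeConjecture.HodgeCM.Model.Junction.LevelChange
import Literature.NumberTheory.Automorphic.LevelOrbitConjugationMeasure

/-!
# Junction J2e: Hecke and rational translates of the piece embedding, read in `Q.H`

For a level piece `M • x ⊆ G₁ ⧸ Γ₁` with projection `π : M →* A` the tree proves (Getz–Hahn (6.8)) that the
`g`-translate of a piece lift is the piece lift at the conjugate level `gMg⁻¹`, base point `g • x`, of the
function transported along `conjCast` (`LevelOrbit.translateLp_pieceLiftLp`), and that twisting `π` by a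
topological isomorphism `c : A ≃ₜ* A'` of the receiving group changes nothing up to `isoCast`
(`LevelOrbit.pieceLiftLp_isoComp`). This file reads both in the package carrier `Q.H = L²(Q.G ⧸ Q.Γ, Q.ν)`
with the package representation `Q.R`:

* `inner_R_R` : `Q.R g` preserves inner products (it is the tree's `translateLp`, junction J2d);
* `R_pieceEmb` : `Q.R (e g) (pieceEmb_{M,π,x} f) = pieceEmb_{gMg⁻¹, π ∘ conj, g • x} (f ∘ conjCast)`;
* `R_pieceEmb'` : the same for a point `g'` of `Q.G` (`g := e⁻¹ g'`);
* for a RATIONAL translate (`γ ∈ Γ₁`, base point `x = 1`) the base point does not move: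
  rewrite `γ • 1 = 1` with the tree's `LevelOrbit.smul_one_eq_of_mem`;
* `pieceEmb_isoComp` : `pieceEmb_{M, c ∘ π, x} f = pieceEmb_{M, π, x} (f ∘ isoCast)`;
* `inner_pieceEmb_conj`, `norm_pieceEmb_conj` : the Petersson data are unchanged under translation.

Everything is proved; 0 hypotheses beyond the data; 0 MODEL-N.
-/

set_option autoImplicit false

noncomputable section

open MeasureTheory Literature.MeasureTheory.Group Literature.NumberTheory.Automorphic
open scoped ENNReal InnerProductSpace

namespace HodgeCM

namespace QuotientModel

open HodgeCM.PerL34 HodgeCM.PerL34.QuotientSmoothing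

/-- **`Q.R g` is unitary on `Q.H`** (inner products): junction with the tree's `inner_translateLp`. -/
theorem inner_R_R (Q : QuotientModel) (g : Q.G) (v' v : Q.H) : ⟪Q.R g v', Q.R g v⟫_ℂ = ⟪v', v⟫_ℂ := by
  rw [R_eq, ρHom_apply, ← translateLp_eq_ρ, ← translateLp_eq_ρ]
  exact LevelOrbit.inner_translateLp Q.ν g v' v

/-- `Q.R g` preserves norms. -/
theorem norm_R (Q : QuotientModel) (g : Q.G) (v : Q.H) : ‖Q.R g v‖ = ‖v‖ := by
  rw [R_eq, ρHom_apply, norm_ρ]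

variable (Q : QuotientModel) {G₁ : Type*} [Group G₁] [TopologicalSpace G₁] [IsTopologicalGroup G₁]
  (Γ₁ : Subgroup G₁) (e : G₁ ≃ₜ* Q.G) (hΓ : ∀ g, e g ∈ Q.Γ ↔ g ∈ Γ₁)
  [MeasurableSpace (G₁ ⧸ Γ₁)] [BorelSpace (G₁ ⧸ Γ₁)]
  (M : Subgroup G₁) {A : Type*} [Group A] [TopologicalSpace A] [IsTopologicalGroup A] (π : M →* A)
  (x : G₁ ⧸ Γ₁) [CompactSpace (A ⧸ LevelOrbit.pieceLattice M Γ₁ π x)]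

/-- **Hecke translate of the piece embedding, in `Q.H`**: `Q.R (e g) ∘ pieceEmb_{M, π, x}` is
`pieceEmb` at the conjugate level `gMg⁻¹`, projection `π ∘ (g⁻¹ · g)`, base point `g • x`, precomposed with the
transport `conjCast : A ⧸ Γ'_{g•x}(gMg⁻¹) ≃ₜ A ⧸ Γ'_x(M)` (the two lattices coincide). -/
theorem R_pieceEmb (hM : IsOpen (M : Set G₁)) (hπ : Continuous π) (g : G₁)
    (f : C(A ⧸ LevelOrbit.pieceLattice M Γ₁ π x, ℂ)) :
    Q.R (e g) (Q.pieceEmb Γ₁ e hΓ M π x hM hπ f) =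
      Q.pieceEmb Γ₁ e hΓ (LevelOrbit.conjLevel M g) (LevelOrbit.conjProj M π g) (g • x)
        (LevelOrbit.isOpen_conjLevel M hM g) (LevelOrbit.continuous_conjProj M π hπ g)
        (f.comp (LevelOrbit.conjCastCM M Γ₁ π g x)) := by
  rw [pieceEmb_apply, ← transportL2_translateLp, LevelOrbit.translateLp_pieceLiftLp, pieceEmb_apply]

/-- The same at a point `g'` of the package group `Q.G` (`g := e⁻¹ g'`). -/
theorem R_pieceEmb' (hM : IsOpen (M : Set G₁)) (hπ : Continuous π) (g' : Q.G)
    (f : C(A ⧸ LevelOrbit.pieceLattice M Γ₁ π x, ℂ)) :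
    Q.R g' (Q.pieceEmb Γ₁ e hΓ M π x hM hπ f) =
      Q.pieceEmb Γ₁ e hΓ (LevelOrbit.conjLevel M (e.symm g')) (LevelOrbit.conjProj M π (e.symm g'))
        (e.symm g' • x) (LevelOrbit.isOpen_conjLevel M hM (e.symm g'))
        (LevelOrbit.continuous_conjProj M π hπ (e.symm g'))
        (f.comp (LevelOrbit.conjCastCM M Γ₁ π (e.symm g') x)) := by
  rw [← Q.R_pieceEmb Γ₁ e hΓ M π x hM hπ (e.symm g') f, ContinuousMulEquiv.apply_symm_apply]

/-- **Petersson data are unchanged under translation** (inner products). -/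
theorem inner_pieceEmb_conj (hM : IsOpen (M : Set G₁)) (hπ : Continuous π) (g : G₁)
    (f' f : C(A ⧸ LevelOrbit.pieceLattice M Γ₁ π x, ℂ)) :
    ⟪Q.pieceEmb Γ₁ e hΓ (LevelOrbit.conjLevel M g) (LevelOrbit.conjProj M π g) (g • x)
        (LevelOrbit.isOpen_conjLevel M hM g) (LevelOrbit.continuous_conjProj M π hπ g)
        (f'.comp (LevelOrbit.conjCastCM M Γ₁ π g x)),
      Q.pieceEmb Γ₁ e hΓ (LevelOrbit.conjLevel M g) (LevelOrbit.conjProj M π g) (g • x)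
        (LevelOrbit.isOpen_conjLevel M hM g) (LevelOrbit.continuous_conjProj M π hπ g)
        (f.comp (LevelOrbit.conjCastCM M Γ₁ π g x))⟫_ℂ =
      ⟪Q.pieceEmb Γ₁ e hΓ M π x hM hπ f', Q.pieceEmb Γ₁ e hΓ M π x hM hπ f⟫_ℂ := by
  rw [← R_pieceEmb, ← R_pieceEmb, inner_R_R]

/-- Petersson data are unchanged under translation (norms). -/
theorem norm_pieceEmb_conj (hM : IsOpen (M : Set G₁)) (hπ : Continuous π) (g : G₁)
    (f : C(A ⧸ LevelOrbit.pieceLattice M Γ₁ π x, ℂ)) :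
    ‖Q.pieceEmb Γ₁ e hΓ (LevelOrbit.conjLevel M g) (LevelOrbit.conjProj M π g) (g • x)
        (LevelOrbit.isOpen_conjLevel M hM g) (LevelOrbit.continuous_conjProj M π hπ g)
        (f.comp (LevelOrbit.conjCastCM M Γ₁ π g x))‖ =
      ‖Q.pieceEmb Γ₁ e hΓ M π x hM hπ f‖ := by
  rw [← R_pieceEmb, norm_R]

/-- **Twisting the projection by `c : A ≃ₜ* A'`** (the archimedean inner automorphism of a rational
translate): `pieceEmb_{M, c ∘ π, x} f = pieceEmb_{M, π, x} (f ∘ isoCast)`. -/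
theorem pieceEmb_isoComp {A' : Type*} [Group A'] [TopologicalSpace A'] [IsTopologicalGroup A']
    (c : A ≃ₜ* A') (hM : IsOpen (M : Set G₁)) (hπ : Continuous π)
    (f : C(A' ⧸ LevelOrbit.pieceLattice M Γ₁ ((c.toMulEquiv : A →* A').comp π) x, ℂ)) :
    Q.pieceEmb Γ₁ e hΓ M ((c.toMulEquiv : A →* A').comp π) x hM (c.continuous.comp hπ) f =
      Q.pieceEmb Γ₁ e hΓ M π x hM hπ (f.comp (LevelOrbit.isoCastCM M Γ₁ π c x)) := by
  rw [pieceEmb_apply, LevelOrbit.pieceLiftLp_isoComp, pieceEmb_apply]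

end QuotientModel

end HodgeCM

end
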